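import Summits.QuantumFields.BalabanUV.Beta.FP.TorusCompositeInsertionPeriodic
import Summits.QuantumFields.BalabanUV.Beta.FP.TorusStepInsertionPeriodicTwo

/-!
# `BalabanUV.Beta.FP.TorusCompositeInsertionPeriodicTwo` — road «FP» for binder row D1, ROUTE T: **THE COMPOSITE SECOND-ORDER INSERTION BI-JET `compIns₂₂ … n h h′`
# ACTS ON PERIODIC 1-FORMS AS ANY LATTICE BI-FUNCTIONAL OBEYING OUR SECOND CHAIN RULE** — the order-2 composite junction (F5 of an2's S-an2-g49-1 §3), typed
# against GENERIC families `𝓘₁` (order 1, R-7's letters) and `𝓘₂` (order 2) satisfying the displayed recursions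

WHY.  `compIns₂₂ Lc M lev rs n h h′` (g26 `TorusCompositeCovarianceTwoPolar`, OUR polarised ♭ second chain rule `compIns₂₂_succ`) peels at the top into THREE summands:
the top step's bi-jet `stepIns₂₂` along the two TRANSPORTED directions `compRows′ *ᵥ h`, `compRows′ *ᵥ h′` composed with the lower rows; the top step's jet `stepIns₁`
along one transported direction composed with the lower composite jet `compIns₁` along the other (both orders); the top rows `Qstep` on the lower bi-jet.  Acting on a
finest-periodic form, R-6 `TorusStepInsertionPeriodicTwo.sum_stepIns₂₂_mul_periodic` (bi-jet ↦ an1's symmetrised `vh2KerAt` at the two lifts), R-5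
`TorusStepInsertionPeriodic.sum_stepIns₁_mul_periodic` with R-7 `TorusCompositeInsertionPeriodic.sum_compIns₁_mul_periodic` (the mixed summands), and R-1
`sum_Qstep_mul_periodic` (the lower summand) turn it into a recursion of LATTICE forms.  THIS FILE proves, for ANY `𝓘₁` with R-7's three letters and ANY `𝓘₂` with
`𝓘₂ … 0 = 0`, the displayed successor clause (`hsucc₂`, OUR recursion verbatim) and top-periodicity (`hper₂`):
`Σ_q compIns₂₂ Lc M lev rs n h h′ (x,κ₀) q · B q.2 q.1 = 𝓘₂ lev rs n (lift h) (lift h′) B κ₀ x`.  No lattice object is DEFINED here (the row's F5 names it).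

[folklore] finite sums BY NAME over OUR bookkeeping objects (`compIns₂₂ ∕ compIns₁ ∕ stepIns₂₂ ∕ stepIns₁ ∕ compRows ∕ Qstep ∕ towerTorus`) and the row's ∕ an1's typed
lattice objects (`compLinAvgAt`, `linAvgAt`, `vhKerAt`, `vh2KerAt`); no `def`, no `def … : Prop`, nothing cited, 0 sorry; NO chart; nothing of Bałaban's asserted (that
the composite's second variation IS this chain is an2's (C1) TABLE word, R-D1-g42-4).  NOT HERE: the row's definitions ∕ bridges; kernel-level packaging; estimates.

HONEST DEPENDENCY (page 1, mandatory): continuum YM on T⁴ ⇐ BetaPertH ∧ nine spine estimates (0/9 proved); BetaPertH ⇐ (D1) ∧ (D4) ∧ CAP+tail;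
G-an2-4 gates asym, D1 and NE2/3/4.  HONEST FRAMING (cell contract, verbatim): «discharging `BetaPertH` makes Bałaban's UV stability UNCONDITIONAL —
a real constructive-QFT result; it is NOT the continuum limit and NOT the Clay problem.»  ABSOLUTE RULE (cell charter, verbatim): «No internally-minted
statement may enter as a cited fact. Every hypothesis is either kernel-proved in this package or a verbatim quotation of a PUBLISHED theorem with page
reference. The manuscript(s) under audit are NOT citable for their own disputed steps — they are the thing under adjudication; programme-internal
(2001/route/tribunal) claims are never citable.»  0 estimates; 0∕4 row-D1 binders (hW, hR, D1Tel, D1Rep); NOT (T-ID), NOT (C1), NOT SDF, NOT D1,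
NOT BetaPertH, NOT continuum, NOT Clay.  D1 formalisation swarm LEAF PROVER 02 (b2b-balaban-beta-d1-formalise-leaf-02 gen 28), 2026-08-23.  No existing file touched.
-/

noncomputable section

open scoped BigOperators

namespace Summit.QuantumFields.BalabanUV.Beta.FP.TorusCompositeInsertionPeriodicTwo

open Matrix Finset
open Literature.MathematicalPhysics.QuantumFieldTheory
open Literature.MathematicalPhysics.QuantumFieldTheory.Balaban1983to89
open Literature.MathematicalPhysics.QuantumFieldTheory.Balaban1983to89.Beta
open B5Prop11Plancherel (fine)
open B6Lemma24Torus (pbox mem_pbox wrap)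
open B4TorusKernel.MultiPeriod (translate translate_apply)
open AffineAveraging (Site Form1 box toSite)
open AveragingContoursRooted (linAvgAt)
open AveragingHessianKernels (Bond)
open AveragingHessianKernelsRooted (vhKerAt)
open AveragingMixedJetTables (vh2KerAt)
open Summit.QuantumFields.BalabanUV.Beta.BorderedHessian (stepScale)
open Summit.QuantumFields.BalabanUV.Beta.FP.TorusGaugeCovariancePairing (wrapPt wrapPt_coe wrapPt_of_mem)
open Summit.QuantumFields.BalabanUV.Beta.FP.TorusCompositeObjects (towerTorus Qstep compRows)
open Summit.QuantumFields.BalabanUV.Beta.CompositeAveragingCoarseExact (compLinAvgAt)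
open Summit.QuantumFields.BalabanUV.Beta.FP.TorusCompositeRowsPeriodic (sum_Qstep_mul_periodic compLinAvgAt_periodic)
open Summit.QuantumFields.BalabanUV.Beta.FP.TorusCompositeCovarianceOne (stepIns₁ compIns₁)
open Summit.QuantumFields.BalabanUV.Beta.FP.TorusCompositeCovarianceTwoPolar (stepIns₂₂ compIns₂₂ compIns₂₂_zero compIns₂₂_succ)
open Summit.QuantumFields.BalabanUV.Beta.FP.TorusStepInsertionPeriodic (sum_stepIns₁_mul_periodic)
open Summit.QuantumFields.BalabanUV.Beta.FP.TorusStepInsertionPeriodicTwo (sum_stepIns₂₂_mul_periodic)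
open Summit.QuantumFields.BalabanUV.Beta.FP.TorusCompositeInsertionPeriodic (sum_compRows_mul_periodic' lift_periodic periodic_apply_wrap compRows_mulVec_eq
  sum_compIns₁_mul_periodic periodic_of_clauses)

variable {d : ℕ} (Lc : ℕ) [NeZero Lc]

/-- [folklore] **`sum_compIns₂₂_mul_periodic` — THE COMPOSITE SECOND-ORDER INSERTION BI-JET ACTS ON PERIODIC 1-FORMS AS ANY LATTICE BI-FUNCTIONAL OBEYING OUR SECOND
CHAIN RULE.**  `𝓘₁` carries R-7's letters `h0₁ hsucc₁ hper₁` (order 1); `𝓘₂ lev rs n H H′ B : Form1` carries `h0₂` (depth 0 is 0), `hsucc₂` — OUR successor clause VERBATIM from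
`compIns₂₂_succ` read through R-6 ∕ R-5+R-7 ∕ R-1: `θ₂ ·` an1's symmetrised `½(vh2KerAt f g g′ + vh2KerAt f g′ g)` at root `toSite (rs 1)` against (the lower composite average
`S′·compLinAvgAt r′ n B`, the two lifted transported directions `S′·compLinAvgAt r′ n H′`, `S′·compLinAvgAt r′ n H`) `+ θ₁ ·` (an1's `vhKerAt` at `toSite (rs 1)` against (the lower
ORDER-1 functional of `(H′, B)`, the lift `S′·compLinAvgAt r′ n H`) + the same with `H ↔ H′`) `+ stepScale d Lc (lev 1) · linAvgAt (toSite (rs 1))` of the lower bi-functional —,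
and `hper₂` (finest-periodic triples ↦ top-periodic forms).  Conclusion: `Σ_q compIns₂₂ Lc M lev rs n h h′ (x,κ₀) q · B q.2 q.1 = 𝓘₂ lev rs n (lift h) (lift h′) B κ₀ x`. -/
theorem sum_compIns₂₂_mul_periodic
    (𝓘₁ : (ℕ → ℕ) → (ℕ → (Fin (d + 1) → ℕ)) → ℕ → Form1 (d + 1) ℝ → Form1 (d + 1) ℝ → Form1 (d + 1) ℝ)
    (h0₁ : ∀ (lev : ℕ → ℕ) (rs : ℕ → (Fin (d + 1) → ℕ)) (H B : Form1 (d + 1) ℝ), 𝓘₁ lev rs 0 H B = 0)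
    (hsucc₁ : ∀ (lev : ℕ → ℕ) (rs : ℕ → (Fin (d + 1) → ℕ)) (n : ℕ) (H B : Form1 (d + 1) ℝ) (κ : Fin (d + 1)) (x : Site (d + 1)),
      𝓘₁ lev rs (n + 1) H B κ x
        = (((Lc : ℝ) ^ (d + 1) * stepScale d Lc (lev 1)) * (∏ i ∈ Finset.range n, (stepScale d Lc (lev (i + 1 + 1)) * ((box (d + 1) Lc).card : ℝ)))⁻¹) *
            (∑' u : Site (d + 1), ∑ κ' : Fin (d + 1),
              (∑' z : Site (d + 1), ∑ l : Fin (d + 1), vhKerAt (toSite (rs 1)) Lc κ x (l, z) (κ', u) *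
                ((∏ i ∈ Finset.range n, stepScale d Lc (lev (i + 1 + 1))) * compLinAvgAt (fun i => rs (n - i + 1)) Lc n B l z)) *
              ((∏ i ∈ Finset.range n, stepScale d Lc (lev (i + 1 + 1))) * compLinAvgAt (fun i => rs (n - i + 1)) Lc n H κ' u))
          + stepScale d Lc (lev 1) * linAvgAt (toSite (rs 1)) (𝓘₁ (fun k => lev (k + 1)) (fun k => rs (k + 1)) n H B) Lc κ x)
    (hper₁ : ∀ (lev : ℕ → ℕ) (rs : ℕ → (Fin (d + 1) → ℕ)) (n : ℕ) (M : Fin (d + 1) → ℕ) (H B : Form1 (d + 1) ℝ),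
      (∀ (l : Fin (d + 1)) (w t : Site (d + 1)), H l (translate (towerTorus Lc M n) w t) = H l w) →
      (∀ (l : Fin (d + 1)) (w t : Site (d + 1)), B l (translate (towerTorus Lc M n) w t) = B l w) →
      ∀ (l : Fin (d + 1)) (y t : Site (d + 1)), 𝓘₁ lev rs n H B l (translate M y t) = 𝓘₁ lev rs n H B l y)
    (𝓘₂ : (ℕ → ℕ) → (ℕ → (Fin (d + 1) → ℕ)) → ℕ → Form1 (d + 1) ℝ → Form1 (d + 1) ℝ → Form1 (d + 1) ℝ → Form1 (d + 1) ℝ)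
    (h0₂ : ∀ (lev : ℕ → ℕ) (rs : ℕ → (Fin (d + 1) → ℕ)) (H H' B : Form1 (d + 1) ℝ), 𝓘₂ lev rs 0 H H' B = 0)
    (hsucc₂ : ∀ (lev : ℕ → ℕ) (rs : ℕ → (Fin (d + 1) → ℕ)) (n : ℕ) (H H' B : Form1 (d + 1) ℝ) (κ₀ : Fin (d + 1)) (x : Site (d + 1)),
      𝓘₂ lev rs (n + 1) H H' B κ₀ x
        = ((((Lc : ℝ) ^ (d + 1) * stepScale d Lc (lev 1)) * (∏ i ∈ Finset.range n, (stepScale d Lc (lev (i + 1 + 1)) * ((box (d + 1) Lc).card : ℝ)))⁻¹)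
            * (∏ i ∈ Finset.range n, (stepScale d Lc (lev (i + 1 + 1)) * ((box (d + 1) Lc).card : ℝ)))⁻¹) *
            (∑' u : Site (d + 1), ∑ κ : Fin (d + 1), (∑' u' : Site (d + 1), ∑ κ' : Fin (d + 1),
              (∑' z : Site (d + 1), ∑ l : Fin (d + 1),
                (1 / 2 : ℝ) * (vh2KerAt (toSite (rs 1)) Lc κ₀ x (l, z) (κ, u) (κ', u') + vh2KerAt (toSite (rs 1)) Lc κ₀ x (l, z) (κ', u') (κ, u)) *
                  ((∏ i ∈ Finset.range n, stepScale d Lc (lev (i + 1 + 1))) * compLinAvgAt (fun i => rs (n - i + 1)) Lc n B l z)) *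
              ((∏ i ∈ Finset.range n, stepScale d Lc (lev (i + 1 + 1))) * compLinAvgAt (fun i => rs (n - i + 1)) Lc n H' κ' u')) *
              ((∏ i ∈ Finset.range n, stepScale d Lc (lev (i + 1 + 1))) * compLinAvgAt (fun i => rs (n - i + 1)) Lc n H κ u))
          + (((Lc : ℝ) ^ (d + 1) * stepScale d Lc (lev 1)) * (∏ i ∈ Finset.range n, (stepScale d Lc (lev (i + 1 + 1)) * ((box (d + 1) Lc).card : ℝ)))⁻¹) *
            ((∑' u : Site (d + 1), ∑ κ' : Fin (d + 1),
              (∑' z : Site (d + 1), ∑ l : Fin (d + 1), vhKerAt (toSite (rs 1)) Lc κ₀ x (l, z) (κ', u) * 𝓘₁ (fun k => lev (k + 1)) (fun k => rs (k + 1)) n H' B l z) *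
                ((∏ i ∈ Finset.range n, stepScale d Lc (lev (i + 1 + 1))) * compLinAvgAt (fun i => rs (n - i + 1)) Lc n H κ' u))
            + (∑' u : Site (d + 1), ∑ κ' : Fin (d + 1),
              (∑' z : Site (d + 1), ∑ l : Fin (d + 1), vhKerAt (toSite (rs 1)) Lc κ₀ x (l, z) (κ', u) * 𝓘₁ (fun k => lev (k + 1)) (fun k => rs (k + 1)) n H B l z) *
                ((∏ i ∈ Finset.range n, stepScale d Lc (lev (i + 1 + 1))) * compLinAvgAt (fun i => rs (n - i + 1)) Lc n H' κ' u)))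
          + stepScale d Lc (lev 1) * linAvgAt (toSite (rs 1)) (𝓘₂ (fun k => lev (k + 1)) (fun k => rs (k + 1)) n H H' B) Lc κ₀ x)
    (hper₂ : ∀ (lev : ℕ → ℕ) (rs : ℕ → (Fin (d + 1) → ℕ)) (n : ℕ) (M : Fin (d + 1) → ℕ) (H H' B : Form1 (d + 1) ℝ),
      (∀ (l : Fin (d + 1)) (w t : Site (d + 1)), H l (translate (towerTorus Lc M n) w t) = H l w) →
      (∀ (l : Fin (d + 1)) (w t : Site (d + 1)), H' l (translate (towerTorus Lc M n) w t) = H' l w) →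
      (∀ (l : Fin (d + 1)) (w t : Site (d + 1)), B l (translate (towerTorus Lc M n) w t) = B l w) →
      ∀ (l : Fin (d + 1)) (y t : Site (d + 1)), 𝓘₂ lev rs n H H' B l (translate M y t) = 𝓘₂ lev rs n H H' B l y) :
    ∀ (n : ℕ) (M : Fin (d + 1) → ℕ) [∀ μ, NeZero (M μ)] (lev : ℕ → ℕ) (rs : ℕ → (Fin (d + 1) → ℕ)) (_ : ∀ k, rs k ∈ box (d + 1) Lc)
      (h h' : ↥(pbox (towerTorus Lc M n)) × Fin (d + 1) → ℝ) (B : Form1 (d + 1) ℝ)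
      (_ : ∀ (l : Fin (d + 1)) (w t : Site (d + 1)), B l (translate (towerTorus Lc M n) w t) = B l w) (x : ↥(pbox M)) (κ₀ : Fin (d + 1)),
      ∑ q : ↥(pbox (towerTorus Lc M n)) × Fin (d + 1), compIns₂₂ Lc M lev rs n h h' (x, κ₀) q * B q.2 (q.1 : Site (d + 1))
        = 𝓘₂ lev rs n (fun l w => h (wrapPt (towerTorus Lc M n) w, l)) (fun l w => h' (wrapPt (towerTorus Lc M n) w, l)) B κ₀ (x : Site (d + 1))
  | 0, M, _, lev, rs, hrs, h, h', B, hB, x, κ₀ => by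
      rw [h0₂, compIns₂₂_zero]
      simp only [Matrix.zero_apply, zero_mul, Finset.sum_const_zero]
      rfl
  | n + 1, M, _, lev, rs, hrs, h, h', B, hB, x, κ₀ => by
      -- spell every finest-torus object over the lower tower `(fine Lc M, n)` (definitionally the same torus, `towerTorus_succ`)
      change ↥(pbox (towerTorus Lc (fine Lc M) n)) × Fin (d + 1) → ℝ at h
      change ↥(pbox (towerTorus Lc (fine Lc M) n)) × Fin (d + 1) → ℝ at h'
      change ∀ (l : Fin (d + 1)) (w t : Site (d + 1)), B l (translate (towerTorus Lc (fine Lc M) n) w t) = B l w at hB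
      show ∑ q : ↥(pbox (towerTorus Lc (fine Lc M) n)) × Fin (d + 1), compIns₂₂ Lc M lev rs (n + 1) h h' (x, κ₀) q * B q.2 (q.1 : Site (d + 1)) = 𝓘₂ lev rs (n
          + 1) (fun l w => h (wrapPt (towerTorus Lc (fine Lc M) n) w, l)) (fun l w => h' (wrapPt (towerTorus Lc (fine Lc M) n) w, l)) B κ₀ (x : Site (d + 1))
      -- the lifted directions are finest-periodic
      have hHper : ∀ (l : Fin (d + 1)) (w t : Site (d + 1)), (fun l w => h (wrapPt (towerTorus Lc (fine Lc M) n) w, l)) l (translate (towerTorus Lc (fine Lc M) n) w t)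
          = (fun l w => h (wrapPt (towerTorus Lc (fine Lc M) n) w, l)) l w :=
        fun l w t => lift_periodic (towerTorus Lc (fine Lc M) n) h l w t
      have hH'per : ∀ (l : Fin (d + 1)) (w t : Site (d + 1)), (fun l w => h' (wrapPt (towerTorus Lc (fine Lc M) n) w, l)) l (translate (towerTorus Lc (fine Lc M) n) w t)
          = (fun l w => h' (wrapPt (towerTorus Lc (fine Lc M) n) w, l)) l w :=
        fun l w t => lift_periodic (towerTorus Lc (fine Lc M) n) h' l w t
      -- induction hypothesis on the lower tower; the ORDER-1 junction (R-7) on the lower tower for each direction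
      have IH := sum_compIns₂₂_mul_periodic 𝓘₁ h0₁ hsucc₁ hper₁ 𝓘₂ h0₂ hsucc₂ hper₂ n (fine Lc M) (fun k => lev (k + 1)) (fun k => rs (k + 1)) (fun k => hrs (k + 1)) h h' B hB
      have I1 := sum_compIns₁_mul_periodic Lc 𝓘₁ h0₁ hsucc₁ hper₁ n (fine Lc M) (fun k => lev (k + 1)) (fun k => rs (k + 1)) (fun k => hrs (k + 1)) h B hB
      have I1' := sum_compIns₁_mul_periodic Lc 𝓘₁ h0₁ hsucc₁ hper₁ n (fine Lc M) (fun k => lev (k + 1)) (fun k => rs (k + 1)) (fun k => hrs (k + 1)) h' B hB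
      -- periodicity under the top box `fine Lc M` of the three lower functionals
      have hI2per := hper₂ (fun k => lev (k + 1)) (fun k => rs (k
          + 1)) n (fine Lc M) (fun l w => h (wrapPt (towerTorus Lc (fine Lc M) n) w, l)) (fun l w => h' (wrapPt (towerTorus Lc (fine Lc M) n) w, l)) B hHper hH'per hB
      have hI1per := hper₁ (fun k => lev (k + 1)) (fun k => rs (k + 1)) n (fine Lc M) (fun l w => h (wrapPt (towerTorus Lc (fine Lc M) n) w, l)) B hHper hB
      have hI1'per := hper₁ (fun k => lev (k + 1)) (fun k => rs (k + 1)) n (fine Lc M) (fun l w => h' (wrapPt (towerTorus Lc (fine Lc M) n) w, l)) B hH'per hB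
      -- the lower composite average of `B` is `fine Lc M`-periodic; the transported directions read at box points
      set S' : ℝ := (∏ i ∈ Finset.range n, stepScale d Lc (lev (i + 1 + 1))) with hS'
      have hBlow' : ∀ (l : Fin (d + 1)) (y t : Site (d + 1)), (fun l z => S' * compLinAvgAt (fun i => rs (n - i + 1)) Lc n B l z) l (translate (fine Lc M) y t) = (fun l z => S'
          * compLinAvgAt (fun i => rs (n - i + 1)) Lc n B l z) l y := fun l y t => by
        show S' * _ = S' * _
        rw [compLinAvgAt_periodic Lc (fine Lc M) n _ B hB]
      have hv : ∀ (u : Site (d + 1)) (κ' : Fin (d + 1)), ((compRows Lc (fine Lc M) (fun k => lev (k + 1)) (fun k => rs (k + 1)) n) *ᵥ h) (wrapPt (fine Lc M) u, κ') = S'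
          * compLinAvgAt (fun i => rs (n - i + 1)) Lc n (fun l w => h (wrapPt (towerTorus Lc (fine Lc M) n) w, l)) κ' u := fun u κ' => by
        rw [compRows_mulVec_eq Lc n (fine Lc M) (fun k => lev (k + 1)) (fun k => rs (k + 1)) (fun k => hrs (k + 1)) h (wrapPt (fine Lc M) u) κ']
        exact congrArg (fun t : ℝ => S' * t) (periodic_apply_wrap (fine Lc M) _ (compLinAvgAt_periodic Lc (fine Lc M) n _ _ hHper) κ' u)
      have hv' : ∀ (u : Site (d + 1)) (κ' : Fin (d + 1)), ((compRows Lc (fine Lc M) (fun k => lev (k + 1)) (fun k => rs (k + 1)) n) *ᵥ h') (wrapPt (fine Lc M) u, κ') = S'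
          * compLinAvgAt (fun i => rs (n - i + 1)) Lc n (fun l w => h' (wrapPt (towerTorus Lc (fine Lc M) n) w, l)) κ' u := fun u κ' => by
        rw [compRows_mulVec_eq Lc n (fine Lc M) (fun k => lev (k + 1)) (fun k => rs (k + 1)) (fun k => hrs (k + 1)) h' (wrapPt (fine Lc M) u) κ']
        exact congrArg (fun t : ℝ => S' * t) (periodic_apply_wrap (fine Lc M) _ (compLinAvgAt_periodic Lc (fine Lc M) n _ _ hH'per) κ' u)
      -- the three lower actions on the slots of `fine Lc M`: rows (R-1), order-1 jets (R-7), the lower bi-jet (induction hypothesis)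
      have hrows : ∀ p : ↥(pbox (fine Lc M)) × Fin (d + 1), ∑ q : ↥(pbox (towerTorus Lc (fine Lc M) n)) × Fin (d + 1), compRows Lc (fine Lc M) (fun k => lev (k + 1)) (fun k => rs (k
          + 1)) n p q * B q.2 (q.1 : Site (d + 1)) = (fun l z => S' * compLinAvgAt (fun i => rs (n - i + 1)) Lc n B l z) p.2 (p.1 : Site (d + 1)) := fun p => by
        obtain ⟨y, l⟩ := p
        exact sum_compRows_mul_periodic' Lc n (fine Lc M) (fun k => lev (k + 1)) (fun k => rs (k + 1)) (fun k => hrs (k + 1)) B hB y l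
      have hlow1 : ∀ p : ↥(pbox (fine Lc M)) × Fin (d + 1), ∑ q : ↥(pbox (towerTorus Lc (fine Lc M) n)) × Fin (d + 1), compIns₁ Lc (fine Lc M) (fun k => lev (k + 1)) (fun k => rs (k
          + 1)) n h p q * B q.2 (q.1 : Site (d + 1)) = 𝓘₁ (fun k => lev (k + 1)) (fun k => rs (k
          + 1)) n (fun l w => h (wrapPt (towerTorus Lc (fine Lc M) n) w, l)) B p.2 (p.1 : Site (d + 1)) :=
        fun p => by obtain ⟨y, l⟩ := p; exact I1 y l
      have hlow1' : ∀ p : ↥(pbox (fine Lc M)) × Fin (d + 1), ∑ q : ↥(pbox (towerTorus Lc (fine Lc M) n)) × Fin (d + 1), compIns₁ Lc (fine Lc M) (fun k => lev (k + 1)) (fun k => rs (k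
          + 1)) n h' p q * B q.2 (q.1 : Site (d + 1)) = 𝓘₁ (fun k => lev (k + 1)) (fun k => rs (k
          + 1)) n (fun l w => h' (wrapPt (towerTorus Lc (fine Lc M) n) w, l)) B p.2 (p.1 : Site (d + 1)) :=
        fun p => by obtain ⟨y, l⟩ := p; exact I1' y l
      have hlow2 : ∀ p : ↥(pbox (fine Lc M)) × Fin (d + 1), ∑ q : ↥(pbox (towerTorus Lc (fine Lc M) n)) × Fin (d + 1), compIns₂₂ Lc (fine Lc M) (fun k => lev (k + 1)) (fun k => rs (k
          + 1)) n h h' p q * B q.2 (q.1 : Site (d + 1)) = 𝓘₂ (fun k => lev (k + 1)) (fun k => rs (k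
          + 1)) n (fun l w => h (wrapPt (towerTorus Lc (fine Lc M) n) w, l)) (fun l w => h' (wrapPt (towerTorus Lc (fine Lc M) n) w, l)) B p.2 (p.1 : Site (d + 1)) :=
        fun p => by obtain ⟨y, l⟩ := p; exact IH y l
      -- a product of matrices acting on the form's values, entrywise (R-1's recipe)
      have hprod : ∀ (X : Matrix (↥(pbox M) × Fin (d + 1)) (↥(pbox (fine Lc M)) × Fin (d + 1)) ℝ) (Y : Matrix (↥(pbox (fine Lc M)) × Fin (d
          + 1)) (↥(pbox (towerTorus Lc (fine Lc M) n)) × Fin (d + 1)) ℝ),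
          ∑ q : ↥(pbox (towerTorus Lc (fine Lc M) n)) × Fin (d + 1), (X * Y) (x, κ₀) q * B q.2 (q.1 : Site (d + 1)) = ∑ p : ↥(pbox (fine Lc M)) × Fin (d + 1), X (x, κ₀) p
              * ∑ q : ↥(pbox (towerTorus Lc (fine Lc M) n)) × Fin (d + 1), Y p q * B q.2 (q.1 : Site (d + 1)) := fun X Y => by
        simp only [Matrix.mul_apply, Finset.sum_mul, Finset.mul_sum, mul_assoc]
        exact Finset.sum_comm
      have hsmul : ∀ (t : ℝ) (X : Matrix (↥(pbox M) × Fin (d + 1)) (↥(pbox (towerTorus Lc (fine Lc M) n)) × Fin (d + 1)) ℝ),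
          ∑ q : ↥(pbox (towerTorus Lc (fine Lc M) n)) × Fin (d + 1), (t • X) (x, κ₀) q * B q.2 (q.1 : Site (d + 1)) = t * ∑ q : ↥(pbox (towerTorus Lc (fine Lc M) n)) × Fin (d
              + 1), X (x, κ₀) q * B q.2 (q.1 : Site (d + 1)) := fun t X => by
        rw [Finset.mul_sum]
        exact Finset.sum_congr rfl fun q _ => by rw [Matrix.smul_apply, smul_eq_mul, mul_assoc]
      -- the chain rule, entrywise: three summands
      rw [hsucc₂, compIns₂₂_succ]
      simp only [Matrix.add_apply, add_mul, Finset.sum_add_distrib]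
      congr 1
      · congr 1
        · -- TOP TERM: unit × (the lower rows through the bi-jet) = R-6 at (S′·compLinAvgAt B, the two lifts)
          rw [hsmul]
          congr 1
          rw [hprod, Finset.sum_congr rfl fun p _ => by rw [hrows p]]
          refine (sum_stepIns₂₂_mul_periodic M Lc (hrs 1) ((compRows Lc (fine Lc M) (fun k => lev (k + 1)) (fun k => rs (k + 1)) n) *ᵥ h) ((compRows Lc (fine Lc M) (fun k => lev (k
              + 1)) (fun k => rs (k + 1)) n) *ᵥ h') (fun l z => S' * compLinAvgAt (fun i => rs (n - i + 1)) Lc n B l z) hBlow' x κ₀).trans ?_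
          refine tsum_congr fun u => Finset.sum_congr rfl fun κ _ => ?_
          rw [hv u κ]
          congr 1
          exact tsum_congr fun u' => Finset.sum_congr rfl fun κ' _ => by rw [hv' u' κ']
        · -- MIXED TERMS: unit × (`stepIns₁` along one transported direction on the lower order-1 functional of the other) = R-5 ∘ R-7, both orders
          rw [hsmul]
          congr 1
          simp only [Matrix.add_apply, add_mul, Finset.sum_add_distrib]
          congr 1
          · rw [hprod, Finset.sum_congr rfl fun p _ => by rw [hlow1' p]]
            exact (sum_stepIns₁_mul_periodic M Lc (hrs 1) ((compRows Lc (fine Lc M) (fun k => lev (k + 1)) (fun k => rs (k + 1)) n) *ᵥ h) (𝓘₁ (fun k => lev (k + 1)) (fun k => rs (k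
                + 1)) n (fun l w => h' (wrapPt (towerTorus Lc (fine Lc M) n) w, l)) B) hI1'per x κ₀).trans
              (tsum_congr fun u => Finset.sum_congr rfl fun κ' _ => by rw [hv u κ'])
          · rw [hprod, Finset.sum_congr rfl fun p _ => by rw [hlow1 p]]
            exact (sum_stepIns₁_mul_periodic M Lc (hrs 1) ((compRows Lc (fine Lc M) (fun k => lev (k + 1)) (fun k => rs (k + 1)) n) *ᵥ h') (𝓘₁ (fun k => lev (k + 1)) (fun k => rs (k
                + 1)) n (fun l w => h (wrapPt (towerTorus Lc (fine Lc M) n) w, l)) B) hI1per x κ₀).trans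
              (tsum_congr fun u => Finset.sum_congr rfl fun κ' _ => by rw [hv' u κ'])
      · -- LOWER TERM: the top rows act as `stepScale · linAvgAt` on the (periodic) lower bi-functional (R-1 `sum_Qstep_mul_periodic`)
        rw [hprod, Finset.sum_congr rfl fun p _ => by rw [hlow2 p]]
        exact sum_Qstep_mul_periodic Lc M (lev 1) (hrs 1) (𝓘₂ (fun k => lev (k + 1)) (fun k => rs (k
            + 1)) n (fun l w => h (wrapPt (towerTorus Lc (fine Lc M) n) w, l)) (fun l w => h' (wrapPt (towerTorus Lc (fine Lc M) n) w, l)) B) hI2per x κ₀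


/-! ## §2 The periodicity letter `hper₂` FOLLOWS from the clauses (order 2) -/

omit [NeZero Lc] in
/-- [folklore] the top summand of the order-2 successor clause is periodic under the top box: for forms `W, W′, B′` periodic under `fine Lc M`, the symmetrised
`vh2KerAt` triple form `x ↦ Σ'_u Σ_κ (Σ'_{u′} Σ_{κ′} (Σ'_z Σ_l ½(vh2KerAt ρ Lc κ₀ x (l,z) (κ,u) (κ′,u′) + (κ,u) ↔ (κ′,u′)) · B′ l z) · W′ κ′ u′) · W κ u` is `M`-periodic
(an1's `vh2KerAt_add`; three bond sums re-indexed by `Equiv.addRight`). -/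
theorem vh2KerAt_form_translate (M : Fin (d + 1) → ℕ) (ρ : Site (d + 1)) (W W' B' : Form1 (d + 1) ℝ)
    (hW : ∀ (l : Fin (d + 1)) (y m : Site (d + 1)), W l (translate (fine Lc M) y m) = W l y)
    (hW' : ∀ (l : Fin (d + 1)) (y m : Site (d + 1)), W' l (translate (fine Lc M) y m) = W' l y)
    (hB' : ∀ (l : Fin (d + 1)) (y m : Site (d + 1)), B' l (translate (fine Lc M) y m) = B' l y) (κ₀ : Fin (d + 1)) (y t : Site (d + 1)) :
    (∑' u : Site (d + 1), ∑ κ : Fin (d + 1), (∑' u' : Site (d + 1), ∑ κ' : Fin (d + 1), (∑' z : Site (d + 1), ∑ l : Fin (d + 1),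
        (1 / 2 : ℝ) * (vh2KerAt ρ Lc κ₀ (translate M y t) (l, z) (κ, u) (κ', u') + vh2KerAt ρ Lc κ₀ (translate M y t) (l, z) (κ', u') (κ, u)) * B' l z)
          * W' κ' u') * W κ u)
      = ∑' u : Site (d + 1), ∑ κ : Fin (d + 1), (∑' u' : Site (d + 1), ∑ κ' : Fin (d + 1), (∑' z : Site (d + 1), ∑ l : Fin (d + 1),
        (1 / 2 : ℝ) * (vh2KerAt ρ Lc κ₀ y (l, z) (κ, u) (κ', u') + vh2KerAt ρ Lc κ₀ y (l, z) (κ', u') (κ, u)) * B' l z) * W' κ' u') * W κ u := by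
  have eadd : ∀ w : Site (d + 1), (w + (fun i => (fine Lc M i : ℤ) * t i)) = translate (fine Lc M) w t := fun w => by
    funext i; simp [B4TorusKernel.MultiPeriod.translate_apply]
  have hy : translate M y t = y + fun i => (M i : ℤ) * t i := by funext i; simp [B4TorusKernel.MultiPeriod.translate_apply]
  have hsh : ∀ (α : Fin (d + 1)) (w : Site (d + 1)),
      ((α, translate (fine Lc M) w t) : Bond (d + 1)) = AveragingHessianKernels.Bond.sh (α, w) ((Lc : ℤ) • fun i => (M i : ℤ) * t i) := fun α w =>
    Prod.ext rfl (funext fun i => by simp [B4TorusKernel.MultiPeriod.translate_apply, fine, Nat.cast_mul, mul_assoc])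
  have hK : ∀ (l : Fin (d + 1)) (z : Site (d + 1)) (κ : Fin (d + 1)) (u : Site (d + 1)) (κ' : Fin (d + 1)) (u' : Site (d + 1)),
      vh2KerAt ρ Lc κ₀ (translate M y t) (l, translate (fine Lc M) z t) (κ, translate (fine Lc M) u t) (κ', translate (fine Lc M) u' t)
        = vh2KerAt ρ Lc κ₀ y (l, z) (κ, u) (κ', u') := fun l z κ u κ' u' => by
    rw [hy, hsh, hsh, hsh]
    exact AveragingMixedJetTables.vh2KerAt_add ρ Lc κ₀ y (fun i => (M i : ℤ) * t i) (l, z) (κ, u) (κ', u')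
  rw [← (Equiv.addRight (fun i => (fine Lc M i : ℤ) * t i)).tsum_eq (fun u => ∑ κ : Fin (d + 1), (∑' u' : Site (d + 1), ∑ κ' : Fin (d + 1), (∑' z : Site (d + 1), ∑ l : Fin (d + 1),
        (1 / 2 : ℝ) * (vh2KerAt ρ Lc κ₀ (translate M y t) (l, z) (κ, u) (κ', u') + vh2KerAt ρ Lc κ₀ (translate M y t) (l, z) (κ', u') (κ, u)) * B' l z)
          * W' κ' u') * W κ u)]
  refine tsum_congr fun u => Finset.sum_congr rfl fun κ _ => ?_
  simp only [Equiv.coe_addRight]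
  rw [eadd u, hW]
  refine congrArg (fun s : ℝ => s * W κ u) ?_
  rw [← (Equiv.addRight (fun i => (fine Lc M i : ℤ) * t i)).tsum_eq (fun u' => ∑ κ' : Fin (d + 1), (∑' z : Site (d + 1), ∑ l : Fin (d + 1),
        (1 / 2 : ℝ) * (vh2KerAt ρ Lc κ₀ (translate M y t) (l, z) (κ, translate (fine Lc M) u t) (κ', u')
          + vh2KerAt ρ Lc κ₀ (translate M y t) (l, z) (κ', u') (κ, translate (fine Lc M) u t)) * B' l z) * W' κ' u')]
  refine tsum_congr fun u' => Finset.sum_congr rfl fun κ' _ => ?_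
  simp only [Equiv.coe_addRight]
  rw [eadd u', hW']
  refine congrArg (fun s : ℝ => s * W' κ' u') ?_
  rw [← (Equiv.addRight (fun i => (fine Lc M i : ℤ) * t i)).tsum_eq (fun z => ∑ l : Fin (d + 1),
        (1 / 2 : ℝ) * (vh2KerAt ρ Lc κ₀ (translate M y t) (l, z) (κ, translate (fine Lc M) u t) (κ', translate (fine Lc M) u' t)
          + vh2KerAt ρ Lc κ₀ (translate M y t) (l, z) (κ', translate (fine Lc M) u' t) (κ, translate (fine Lc M) u t)) * B' l z)]
  refine tsum_congr fun z => Finset.sum_congr rfl fun l _ => ?_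
  simp only [Equiv.coe_addRight]
  rw [eadd z, hB', hK, hK]

omit [NeZero Lc] in
/-- [folklore] **`periodic_of_clauses₂` — THE LETTER `hper₂` OF `sum_compIns₂₂_mul_periodic` FOLLOWS FROM THE CLAUSES** (`h0₁ hsucc₁` of order 1 for the mixed summands
through R-7's `periodic_of_clauses`; `h0₂ hsucc₂`): finest-periodic `(H, H′, B)` ↦ `M`-periodic `𝓘₂ lev rs n H H′ B`. -/
theorem periodic_of_clauses₂
    (𝓘₁ : (ℕ → ℕ) → (ℕ → (Fin (d + 1) → ℕ)) → ℕ → Form1 (d + 1) ℝ → Form1 (d + 1) ℝ → Form1 (d + 1) ℝ)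
    (h0₁ : ∀ (lev : ℕ → ℕ) (rs : ℕ → (Fin (d + 1) → ℕ)) (H B : Form1 (d + 1) ℝ), 𝓘₁ lev rs 0 H B = 0)
    (hsucc₁ : ∀ (lev : ℕ → ℕ) (rs : ℕ → (Fin (d + 1) → ℕ)) (n : ℕ) (H B : Form1 (d + 1) ℝ) (κ : Fin (d + 1)) (x : Site (d + 1)),
      𝓘₁ lev rs (n + 1) H B κ x
        = (((Lc : ℝ) ^ (d + 1) * stepScale d Lc (lev 1)) * (∏ i ∈ Finset.range n, (stepScale d Lc (lev (i + 1 + 1)) * ((box (d + 1) Lc).card : ℝ)))⁻¹) *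
            (∑' u : Site (d + 1), ∑ κ' : Fin (d + 1),
              (∑' z : Site (d + 1), ∑ l : Fin (d + 1), vhKerAt (toSite (rs 1)) Lc κ x (l, z) (κ', u) *
                ((∏ i ∈ Finset.range n, stepScale d Lc (lev (i + 1 + 1))) * compLinAvgAt (fun i => rs (n - i + 1)) Lc n B l z)) *
              ((∏ i ∈ Finset.range n, stepScale d Lc (lev (i + 1 + 1))) * compLinAvgAt (fun i => rs (n - i + 1)) Lc n H κ' u))
          + stepScale d Lc (lev 1) * linAvgAt (toSite (rs 1)) (𝓘₁ (fun k => lev (k + 1)) (fun k => rs (k + 1)) n H B) Lc κ x)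
    (𝓘₂ : (ℕ → ℕ) → (ℕ → (Fin (d + 1) → ℕ)) → ℕ → Form1 (d + 1) ℝ → Form1 (d + 1) ℝ → Form1 (d + 1) ℝ → Form1 (d + 1) ℝ)
    (h0₂ : ∀ (lev : ℕ → ℕ) (rs : ℕ → (Fin (d + 1) → ℕ)) (H H' B : Form1 (d + 1) ℝ), 𝓘₂ lev rs 0 H H' B = 0)
    (hsucc₂ : ∀ (lev : ℕ → ℕ) (rs : ℕ → (Fin (d + 1) → ℕ)) (n : ℕ) (H H' B : Form1 (d + 1) ℝ) (κ₀ : Fin (d + 1)) (x : Site (d + 1)),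
      𝓘₂ lev rs (n + 1) H H' B κ₀ x
        = ((((Lc : ℝ) ^ (d + 1) * stepScale d Lc (lev 1)) * (∏ i ∈ Finset.range n, (stepScale d Lc (lev (i + 1 + 1)) * ((box (d + 1) Lc).card : ℝ)))⁻¹) * (∏ i ∈ Finset.range n, (stepScale d Lc (lev (i + 1 + 1)) * ((box (d + 1) Lc).card : ℝ)))⁻¹) *
            (∑' u : Site (d + 1), ∑ κ : Fin (d + 1), (∑' u' : Site (d + 1), ∑ κ' : Fin (d + 1),
              (∑' z : Site (d + 1), ∑ l : Fin (d + 1),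
                (1 / 2 : ℝ) * (vh2KerAt (toSite (rs 1)) Lc κ₀ x (l, z) (κ, u) (κ', u') + vh2KerAt (toSite (rs 1)) Lc κ₀ x (l, z) (κ', u') (κ, u)) *
                  ((∏ i ∈ Finset.range n, stepScale d Lc (lev (i + 1 + 1))) * compLinAvgAt (fun i => rs (n - i + 1)) Lc n B l z)) *
              ((∏ i ∈ Finset.range n, stepScale d Lc (lev (i + 1 + 1))) * compLinAvgAt (fun i => rs (n - i + 1)) Lc n H' κ' u')) *
              ((∏ i ∈ Finset.range n, stepScale d Lc (lev (i + 1 + 1))) * compLinAvgAt (fun i => rs (n - i + 1)) Lc n H κ u))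
          + (((Lc : ℝ) ^ (d + 1) * stepScale d Lc (lev 1)) * (∏ i ∈ Finset.range n, (stepScale d Lc (lev (i + 1 + 1)) * ((box (d + 1) Lc).card : ℝ)))⁻¹) *
            ((∑' u : Site (d + 1), ∑ κ' : Fin (d + 1),
              (∑' z : Site (d + 1), ∑ l : Fin (d + 1), vhKerAt (toSite (rs 1)) Lc κ₀ x (l, z) (κ', u) * 𝓘₁ (fun k => lev (k + 1)) (fun k => rs (k + 1)) n H' B l z) *
                ((∏ i ∈ Finset.range n, stepScale d Lc (lev (i + 1 + 1))) * compLinAvgAt (fun i => rs (n - i + 1)) Lc n H κ' u))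
            + (∑' u : Site (d + 1), ∑ κ' : Fin (d + 1),
              (∑' z : Site (d + 1), ∑ l : Fin (d + 1), vhKerAt (toSite (rs 1)) Lc κ₀ x (l, z) (κ', u) * 𝓘₁ (fun k => lev (k + 1)) (fun k => rs (k + 1)) n H B l z) *
                ((∏ i ∈ Finset.range n, stepScale d Lc (lev (i + 1 + 1))) * compLinAvgAt (fun i => rs (n - i + 1)) Lc n H' κ' u)))
          + stepScale d Lc (lev 1) * linAvgAt (toSite (rs 1)) (𝓘₂ (fun k => lev (k + 1)) (fun k => rs (k + 1)) n H H' B) Lc κ₀ x) :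
    ∀ (n : ℕ) (lev : ℕ → ℕ) (rs : ℕ → (Fin (d + 1) → ℕ)) (M : Fin (d + 1) → ℕ) (H H' B : Form1 (d + 1) ℝ),
      (∀ (l : Fin (d + 1)) (w t : Site (d + 1)), H l (translate (towerTorus Lc M n) w t) = H l w) →
      (∀ (l : Fin (d + 1)) (w t : Site (d + 1)), H' l (translate (towerTorus Lc M n) w t) = H' l w) →
      (∀ (l : Fin (d + 1)) (w t : Site (d + 1)), B l (translate (towerTorus Lc M n) w t) = B l w) →
      ∀ (l : Fin (d + 1)) (y t : Site (d + 1)), 𝓘₂ lev rs n H H' B l (translate M y t) = 𝓘₂ lev rs n H H' B l y := by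
  intro n
  induction n with
  | zero => intro lev rs M H H' B _ _ _ l y t; rw [h0₂]; rfl
  | succ n IH =>
      intro lev rs M H H' B hH hH' hB l y t
      change ∀ (l : Fin (d + 1)) (w t : Site (d + 1)), H l (translate (towerTorus Lc (fine Lc M) n) w t) = H l w at hH
      change ∀ (l : Fin (d + 1)) (w t : Site (d + 1)), H' l (translate (towerTorus Lc (fine Lc M) n) w t) = H' l w at hH'
      change ∀ (l : Fin (d + 1)) (w t : Site (d + 1)), B l (translate (towerTorus Lc (fine Lc M) n) w t) = B l w at hB
      have IH' := IH (fun k => lev (k + 1)) (fun k => rs (k + 1)) (fine Lc M) H H' B hH hH' hB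
      have I1 := periodic_of_clauses Lc 𝓘₁ h0₁ hsucc₁ n (fun k => lev (k + 1)) (fun k => rs (k + 1)) (fine Lc M) H B hH hB
      have I1' := periodic_of_clauses Lc 𝓘₁ h0₁ hsucc₁ n (fun k => lev (k + 1)) (fun k => rs (k + 1)) (fine Lc M) H' B hH' hB
      have hSl : ∀ (F : Form1 (d + 1) ℝ), (∀ (l : Fin (d + 1)) (w t : Site (d + 1)), F l (translate (towerTorus Lc (fine Lc M) n) w t) = F l w) →
          ∀ (l : Fin (d + 1)) (y m : Site (d + 1)),
            (fun l z => (∏ i ∈ Finset.range n, stepScale d Lc (lev (i + 1 + 1))) * compLinAvgAt (fun i => rs (n - i + 1)) Lc n F l z) l (translate (fine Lc M) y m) = (fun l z => (∏ i ∈ Finset.range n, stepScale d Lc (lev (i + 1 + 1))) * compLinAvgAt (fun i => rs (n - i + 1)) Lc n F l z) l y := fun F hF l y m => by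
        show _ * _ = _ * _
        rw [compLinAvgAt_periodic Lc (fine Lc M) n _ F hF]
      have htop := vh2KerAt_form_translate Lc M (toSite (rs 1)) (fun l z => (∏ i ∈ Finset.range n, stepScale d Lc (lev (i + 1 + 1))) * compLinAvgAt (fun i => rs (n - i + 1)) Lc n H l z) (fun l z => (∏ i ∈ Finset.range n, stepScale d Lc (lev (i + 1 + 1))) * compLinAvgAt (fun i => rs (n - i + 1)) Lc n H' l z)
        (fun l z => (∏ i ∈ Finset.range n, stepScale d Lc (lev (i + 1 + 1))) * compLinAvgAt (fun i => rs (n - i + 1)) Lc n B l z) (hSl H hH) (hSl H' hH') (hSl B hB) l y t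
      have hmix := TorusCompositeInsertionPeriodic.vhKerAt_form_translate Lc M (toSite (rs 1)) (fun l z => (∏ i ∈ Finset.range n, stepScale d Lc (lev (i + 1 + 1))) * compLinAvgAt (fun i => rs (n - i + 1)) Lc n H l z)
        (𝓘₁ (fun k => lev (k + 1)) (fun k => rs (k + 1)) n H' B) (hSl H hH) I1' l y t
      have hmix' := TorusCompositeInsertionPeriodic.vhKerAt_form_translate Lc M (toSite (rs 1)) (fun l z => (∏ i ∈ Finset.range n, stepScale d Lc (lev (i + 1 + 1))) * compLinAvgAt (fun i => rs (n - i + 1)) Lc n H' l z)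
        (𝓘₁ (fun k => lev (k + 1)) (fun k => rs (k + 1)) n H B) (hSl H' hH') I1 l y t
      have hlow := TorusCompositeInsertionPeriodic.linAvgAt_translate_of_periodic Lc M (toSite (rs 1)) _ IH' l y t
      rw [hsucc₂, hsucc₂, hlow, htop, hmix, hmix']

/-- [folklore] **`sum_compIns₂₂_mul_periodic'` — R-8's junction WITH ONLY THE CLAUSES `h0₁ hsucc₁ h0₂ hsucc₂` AS LETTERS** (periodicity by `periodic_of_clauses₂` and R-7's
`periodic_of_clauses`). -/
theorem sum_compIns₂₂_mul_periodic'
    (𝓘₁ : (ℕ → ℕ) → (ℕ → (Fin (d + 1) → ℕ)) → ℕ → Form1 (d + 1) ℝ → Form1 (d + 1) ℝ → Form1 (d + 1) ℝ)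
    (h0₁ : ∀ (lev : ℕ → ℕ) (rs : ℕ → (Fin (d + 1) → ℕ)) (H B : Form1 (d + 1) ℝ), 𝓘₁ lev rs 0 H B = 0)
    (hsucc₁ : ∀ (lev : ℕ → ℕ) (rs : ℕ → (Fin (d + 1) → ℕ)) (n : ℕ) (H B : Form1 (d + 1) ℝ) (κ : Fin (d + 1)) (x : Site (d + 1)),
      𝓘₁ lev rs (n + 1) H B κ x
        = (((Lc : ℝ) ^ (d + 1) * stepScale d Lc (lev 1)) * (∏ i ∈ Finset.range n, (stepScale d Lc (lev (i + 1 + 1)) * ((box (d + 1) Lc).card : ℝ)))⁻¹) *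
            (∑' u : Site (d + 1), ∑ κ' : Fin (d + 1),
              (∑' z : Site (d + 1), ∑ l : Fin (d + 1), vhKerAt (toSite (rs 1)) Lc κ x (l, z) (κ', u) *
                ((∏ i ∈ Finset.range n, stepScale d Lc (lev (i + 1 + 1))) * compLinAvgAt (fun i => rs (n - i + 1)) Lc n B l z)) *
              ((∏ i ∈ Finset.range n, stepScale d Lc (lev (i + 1 + 1))) * compLinAvgAt (fun i => rs (n - i + 1)) Lc n H κ' u))
          + stepScale d Lc (lev 1) * linAvgAt (toSite (rs 1)) (𝓘₁ (fun k => lev (k + 1)) (fun k => rs (k + 1)) n H B) Lc κ x)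
    (𝓘₂ : (ℕ → ℕ) → (ℕ → (Fin (d + 1) → ℕ)) → ℕ → Form1 (d + 1) ℝ → Form1 (d + 1) ℝ → Form1 (d + 1) ℝ → Form1 (d + 1) ℝ)
    (h0₂ : ∀ (lev : ℕ → ℕ) (rs : ℕ → (Fin (d + 1) → ℕ)) (H H' B : Form1 (d + 1) ℝ), 𝓘₂ lev rs 0 H H' B = 0)
    (hsucc₂ : ∀ (lev : ℕ → ℕ) (rs : ℕ → (Fin (d + 1) → ℕ)) (n : ℕ) (H H' B : Form1 (d + 1) ℝ) (κ₀ : Fin (d + 1)) (x : Site (d + 1)),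
      𝓘₂ lev rs (n + 1) H H' B κ₀ x
        = ((((Lc : ℝ) ^ (d + 1) * stepScale d Lc (lev 1)) * (∏ i ∈ Finset.range n, (stepScale d Lc (lev (i + 1 + 1)) * ((box (d + 1) Lc).card : ℝ)))⁻¹) * (∏ i ∈ Finset.range n, (stepScale d Lc (lev (i + 1 + 1)) * ((box (d + 1) Lc).card : ℝ)))⁻¹) *
            (∑' u : Site (d + 1), ∑ κ : Fin (d + 1), (∑' u' : Site (d + 1), ∑ κ' : Fin (d + 1),
              (∑' z : Site (d + 1), ∑ l : Fin (d + 1),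
                (1 / 2 : ℝ) * (vh2KerAt (toSite (rs 1)) Lc κ₀ x (l, z) (κ, u) (κ', u') + vh2KerAt (toSite (rs 1)) Lc κ₀ x (l, z) (κ', u') (κ, u)) *
                  ((∏ i ∈ Finset.range n, stepScale d Lc (lev (i + 1 + 1))) * compLinAvgAt (fun i => rs (n - i + 1)) Lc n B l z)) *
              ((∏ i ∈ Finset.range n, stepScale d Lc (lev (i + 1 + 1))) * compLinAvgAt (fun i => rs (n - i + 1)) Lc n H' κ' u')) *
              ((∏ i ∈ Finset.range n, stepScale d Lc (lev (i + 1 + 1))) * compLinAvgAt (fun i => rs (n - i + 1)) Lc n H κ u))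
          + (((Lc : ℝ) ^ (d + 1) * stepScale d Lc (lev 1)) * (∏ i ∈ Finset.range n, (stepScale d Lc (lev (i + 1 + 1)) * ((box (d + 1) Lc).card : ℝ)))⁻¹) *
            ((∑' u : Site (d + 1), ∑ κ' : Fin (d + 1),
              (∑' z : Site (d + 1), ∑ l : Fin (d + 1), vhKerAt (toSite (rs 1)) Lc κ₀ x (l, z) (κ', u) * 𝓘₁ (fun k => lev (k + 1)) (fun k => rs (k + 1)) n H' B l z) *
                ((∏ i ∈ Finset.range n, stepScale d Lc (lev (i + 1 + 1))) * compLinAvgAt (fun i => rs (n - i + 1)) Lc n H κ' u))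
            + (∑' u : Site (d + 1), ∑ κ' : Fin (d + 1),
              (∑' z : Site (d + 1), ∑ l : Fin (d + 1), vhKerAt (toSite (rs 1)) Lc κ₀ x (l, z) (κ', u) * 𝓘₁ (fun k => lev (k + 1)) (fun k => rs (k + 1)) n H B l z) *
                ((∏ i ∈ Finset.range n, stepScale d Lc (lev (i + 1 + 1))) * compLinAvgAt (fun i => rs (n - i + 1)) Lc n H' κ' u)))
          + stepScale d Lc (lev 1) * linAvgAt (toSite (rs 1)) (𝓘₂ (fun k => lev (k + 1)) (fun k => rs (k + 1)) n H H' B) Lc κ₀ x)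
    (n : ℕ) (M : Fin (d + 1) → ℕ) [∀ μ, NeZero (M μ)] (lev : ℕ → ℕ) (rs : ℕ → (Fin (d + 1) → ℕ)) (hrs : ∀ k, rs k ∈ box (d + 1) Lc)
    (h h' : ↥(pbox (towerTorus Lc M n)) × Fin (d + 1) → ℝ) (B : Form1 (d + 1) ℝ)
    (hB : ∀ (l : Fin (d + 1)) (w t : Site (d + 1)), B l (translate (towerTorus Lc M n) w t) = B l w) (x : ↥(pbox M)) (κ₀ : Fin (d + 1)) :
    ∑ q : ↥(pbox (towerTorus Lc M n)) × Fin (d + 1), compIns₂₂ Lc M lev rs n h h' (x, κ₀) q * B q.2 (q.1 : Site (d + 1))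
      = 𝓘₂ lev rs n (fun l w => h (wrapPt (towerTorus Lc M n) w, l)) (fun l w => h' (wrapPt (towerTorus Lc M n) w, l)) B κ₀ (x : Site (d + 1)) :=
  sum_compIns₂₂_mul_periodic Lc 𝓘₁ h0₁ hsucc₁ (fun lev rs n M H B => periodic_of_clauses Lc 𝓘₁ h0₁ hsucc₁ n lev rs M H B) 𝓘₂ h0₂ hsucc₂
    (fun lev rs n M H H' B => periodic_of_clauses₂ Lc 𝓘₁ h0₁ hsucc₁ 𝓘₂ h0₂ hsucc₂ n lev rs M H H' B) n M lev rs hrs h h' B hB x κ₀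

end Summit.QuantumFields.BalabanUV.Beta.FP.TorusCompositeInsertionPeriodicTwo

end
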